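import Summits.KontsevichZagierPeriods.KontsevichZagierPeriods.Theorems.SoloBlindSecondTraces
import Summits.KontsevichZagierPeriods.KontsevichZagierPeriods.Theorems.SoloBlindGreenDatum
import Summits.KontsevichZagierPeriods.KontsevichZagierPeriods.Theorems.SoloBlindBeta
import HarnessLib

/-!
# The second-kind form, VI: the primitive behind the regularised Beta value

With `σ = α + β ∈ (-1, 0)`, `-1 < α`, the regularised Beta integrand
`R(v) = (v^α - v^σ)(1-v)^{-σ-2}` of `SoloBlindSecondTraces` satisfies, on `(0,1)`,

  `(σ+1) R(v) - β v^α (1-v)^{-σ-1} = ρ'(v)`,   `ρ(v) = (v^{α+1} - v^{σ+1}) (1-v)^{-σ-1}`,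

and `ρ` is continuous on `[0,1]` with `ρ(0) = ρ(1) = 0` (at `v = 1` the factor
`v^{α+1} - v^{σ+1} = O(1-v)` beats `(1-v)^{-σ-1}`).  This is the Newton–Leibniz input for
`(σ+1) ∫₀¹ R = β B(α+1, -σ)` inside the Kontsevich–Zagier rules (`SoloBlindSecondBeta`).
-/

noncomputable section

open Set MeasureTheory Filter
open scoped Topology
open Literature.NumberTheory.Transcendental
open Literature.NumberTheory.Transcendental.KZ
open Literature.Analysis.SpecialFunctions.Selberg

namespace Summit.KontsevichZagierPeriods.KontsevichZagierPeriods.Theorems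

namespace SoloBlind

/-- The primitive `ρ(v) = (v^{α+1} - v^{α+β+1}) (1-v)^{-α-β-1}`. -/
def secRho (α β v : ℝ) : ℝ := (v ^ (α + 1) - v ^ (α + β + 1)) * (1 - v) ^ (-α - β - 1)

/-- The exact integrand `ρ' = (σ+1) R - β v^α (1-v)^{-σ-1}` on `(0,1)`, extended by `0`. -/
def secExact (α β v : ℝ) : ℝ :=
  if v ∈ Ioo (0 : ℝ) 1 then
    (α + β + 1) * regInt α β v - β * (v ^ α * (1 - v) ^ (-α - β - 1))
  else 0

/-- `ρ(0) = 0` (`α + 1, σ + 1 ≠ 0`). -/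
theorem secRho_zero {α β : ℝ} (hα : -1 < α) (hs : -1 < α + β) : secRho α β 0 = 0 := by
  rw [secRho, Real.zero_rpow (by linarith), Real.zero_rpow (by linarith), sub_self, zero_mul]

/-- `ρ(1) = 0`. -/
theorem secRho_one (α β : ℝ) : secRho α β 1 = 0 := by
  rw [secRho, Real.one_rpow, Real.one_rpow, sub_self, zero_mul]

/-- **`ρ' = (σ+1) R - β v^α (1-v)^{-σ-1}` on `(0,1)`.** -/
theorem hasDerivAt_secRho (α β : ℝ) {v : ℝ} (hv : v ∈ Ioo (0 : ℝ) 1) :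
    HasDerivAt (secRho α β)
      ((α + β + 1) * regInt α β v - β * (v ^ α * (1 - v) ^ (-α - β - 1))) v := by
  have hv0 : v ≠ 0 := hv.1.ne'
  have h1v : 1 - v ≠ 0 := (sub_pos.mpr hv.2).ne'
  have hfun : secRho α β = fun t => t ^ (α + 1) * (1 - t) ^ (-α - β - 1) -
      t ^ (α + β + 1) * (1 - t) ^ (-α - β - 1) := by
    funext t; simp only [secRho]; ring
  rw [hfun]
  have h1 := hasDerivAt_rpow_mul_one_sub_rpow (a := α + 1) (b := -α - β - 1) hv
  have h2 := hasDerivAt_rpow_mul_one_sub_rpow (a := α + β + 1) (b := -α - β - 1) hv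
  refine (h1.sub h2).congr_deriv ?_
  rw [add_sub_cancel_right, add_sub_cancel_right, show -α - β - 1 - 1 = -α - β - 2 by ring,
    regInt]
  have eP : v ^ (α + 1) = v ^ α * v := Real.rpow_add_one hv0 α
  have eQ : v ^ (α + β + 1) = v ^ (α + β) * v := Real.rpow_add_one hv0 (α + β)
  have eW : (1 - v) ^ (-α - β - 1) = (1 - v) ^ (-α - β - 2) * (1 - v) := by
    rw [← Real.rpow_add_one h1v]; congr 1; ring
  rw [eP, eQ, eW]
  ring

/-- Continuity of `ρ` on `[0,1)` (`α + 1, σ + 1 > 0`). -/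
theorem continuousOn_secRho_Ico {α β : ℝ} (hα : -1 < α) (hs : -1 < α + β) :
    ContinuousOn (secRho α β) (Ico 0 1) := by
  intro v hv
  have h1v : 1 - v ≠ 0 := (sub_pos.mpr hv.2).ne'
  have hc : ContinuousAt (fun v : ℝ => (1 - v) ^ (-α - β - 1)) v :=
    (Real.continuousAt_rpow_const (1 - v) (-α - β - 1) (Or.inl h1v)).comp
      (f := fun v : ℝ => 1 - v) (by fun_prop : Continuous fun v : ℝ => 1 - v).continuousAt
  exact (((Real.continuousAt_rpow_const v (α + 1) (Or.inr (by linarith))).sub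
    (Real.continuousAt_rpow_const v (α + β + 1) (Or.inr (by linarith)))).mul hc).continuousWithinAt

/-- The decay `|ρ(v)| ≤ 2 (1-v)^{-σ}` on `[½, 1)` (`-1 < α`, `β ∈ [-1, 0]`). -/
theorem abs_secRho_le {α β : ℝ} (hα : -1 < α) (hβ : -1 ≤ β) (hβ0 : β ≤ 0) {v : ℝ}
    (hv : v ∈ Ico (1 / 2 : ℝ) 1) : |secRho α β v| ≤ 2 * (1 - v) ^ (-α - β) := by
  obtain ⟨hvh, hv1⟩ := hv
  have hv0 : 0 < v := by linarith
  have h1 : 0 < 1 - v := by linarith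
  have hpa : 0 < v ^ (α + 1) := Real.rpow_pos_of_pos hv0 _
  have hpa1 : v ^ (α + 1) ≤ 1 := Real.rpow_le_one hv0.le hv1.le (by linarith)
  have hpc : 0 < (1 - v) ^ (-α - β - 1) := Real.rpow_pos_of_pos h1 _
  have hvb : v ^ (α + β + 1) = v ^ (α + 1) * v ^ β := by
    rw [show α + β + 1 = (α + 1) + β by ring, Real.rpow_add hv0]
  have hb1 : 1 ≤ v ^ β := Real.one_le_rpow_of_pos_of_le_one_of_nonpos hv0 hv1.le hβ0
  have hb2 : v ^ β ≤ v ^ (-1 : ℝ) := Real.rpow_le_rpow_of_exponent_ge hv0 hv1.le hβ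
  rw [Real.rpow_neg_one] at hb2
  have hinv : v⁻¹ ≤ 1 + 2 * (1 - v) := by
    rw [inv_le_iff_one_le_mul₀ hv0]; nlinarith
  have habs : |v ^ (α + 1) - v ^ (α + β + 1)| ≤ 2 * (1 - v) := by
    rw [hvb, show v ^ (α + 1) - v ^ (α + 1) * v ^ β = -(v ^ (α + 1) * (v ^ β - 1)) by ring,
      abs_neg, abs_of_nonneg (by nlinarith)]
    nlinarith [mul_le_mul hpa1 (by linarith : v ^ β - 1 ≤ 2 * (1 - v)) (by linarith) zero_le_one]
  have hW : (1 - v) ^ (-α - β) = (1 - v) * (1 - v) ^ (-α - β - 1) := by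
    rw [show -α - β = (-α - β - 1) + 1 by ring, Real.rpow_add_one h1.ne']; ring
  rw [secRho, abs_mul, abs_of_pos hpc, hW]
  calc |v ^ (α + 1) - v ^ (α + β + 1)| * (1 - v) ^ (-α - β - 1)
      ≤ 2 * (1 - v) * (1 - v) ^ (-α - β - 1) := mul_le_mul_of_nonneg_right habs hpc.le
    _ = _ := by ring

/-- `ρ(v) → 0` as `v → 1⁻` (`-1 < σ < 0`). -/
theorem tendsto_secRho_one {α β : ℝ} (hα : -1 < α) (hβ : -1 ≤ β) (hβ0 : β ≤ 0)
    (hs0 : α + β < 0) : Tendsto (secRho α β) (𝓝[<] 1) (𝓝 0) := by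
  have hB : Tendsto (fun v : ℝ => 2 * (1 - v) ^ (-α - β)) (𝓝[<] 1) (𝓝 0) := by
    have hc : ContinuousAt (fun v : ℝ => 2 * (1 - v) ^ (-α - β)) 1 := by
      have h := (Real.continuousAt_rpow_const (1 - 1) (-α - β) (Or.inr (by linarith))).comp
        (f := fun v : ℝ => 1 - v) (by fun_prop : Continuous fun v : ℝ => 1 - v).continuousAt
      exact continuousAt_const.mul h
    have h := hc.tendsto
    rw [sub_self, Real.zero_rpow (by linarith), mul_zero] at h
    exact h.mono_left nhdsWithin_le_nhds
  have hB' : Tendsto (fun v : ℝ => -(2 * (1 - v) ^ (-α - β))) (𝓝[<] 1) (𝓝 0) := by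
    simpa using hB.neg
  have hev : ∀ᶠ v in 𝓝[<] (1 : ℝ), v ∈ Ioo (1 / 2 : ℝ) 1 := Ioo_mem_nhdsLT (by norm_num)
  refine tendsto_of_tendsto_of_tendsto_of_le_of_le' hB' hB ?_ ?_
  · filter_upwards [hev] with v hv
    have h := abs_secRho_le hα hβ hβ0 ⟨hv.1.le, hv.2⟩
    exact neg_le_of_abs_le h
  · filter_upwards [hev] with v hv
    exact le_of_abs_le (abs_secRho_le hα hβ hβ0 ⟨hv.1.le, hv.2⟩)

/-- **`ρ` is continuous on `[0,1]`.** -/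
theorem continuousOn_secRho {α β : ℝ} (hα : -1 < α) (hβ : -1 ≤ β) (hβ0 : β ≤ 0)
    (hs : -1 < α + β) (hs0 : α + β < 0) : ContinuousOn (secRho α β) (Icc 0 1) :=
  GreenDatum.continuousOn_Icc_of_tendsto (continuousOn_secRho_Ico hα hs) (secRho_one α β)
    (tendsto_secRho_one hα hβ hβ0 hs0)

/-- The exact integrand is integrable on `[0,1]`. -/
theorem integrableOn_secExact {α β : ℝ} (hα : -1 < α) (hβ : -1 ≤ β) (hβ0 : β ≤ 0)
    (hs : -1 < α + β) (hs0 : α + β < 0) : IntegrableOn (secExact α β) (Icc 0 1) := by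
  rw [integrableOn_Icc_iff_integrableOn_Ioo]
  have hB := (integrableOn_Ioo_rpow_mul_one_sub_rpow_and_integral_eq (a := α + 1)
    (b := -α - β) (by linarith) (by linarith)).1
  have h : IntegrableOn (fun v : ℝ => (α + β + 1) * regInt α β v -
      β * (v ^ (α + 1 - 1) * (1 - v) ^ (-α - β - 1))) (Ioo 0 1) :=
    ((integrableOn_regInt hα hβ hβ0 hs hs0).const_mul _).sub (hB.const_mul _)
  refine h.congr_fun (fun v hv => ?_) measurableSet_Ioo
  rw [secExact, if_pos hv, add_sub_cancel_right]

/-- On `(0,1)` the exact integrand is the combination. -/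
theorem secExact_of_mem {α β v : ℝ} (hv : v ∈ Ioo (0 : ℝ) 1) :
    secExact α β v = (α + β + 1) * regInt α β v - β * (v ^ α * (1 - v) ^ (-α - β - 1)) := by
  rw [secExact, if_pos hv]

end SoloBlind

end Summit.KontsevichZagierPeriods.KontsevichZagierPeriods.Theorems
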